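import Summits.QuantumFields.YangMills.Theses.MultiscaleHerbst

/-!
# Assembly of route `MultiscaleHerbst` (rung R3 of LADDER-YM; ideator seat ym-r3-idea-2 g5)

The route file's kernel-checked deciding theorem `closes` packaged as the proof of the route's `Assembly` item (stmt-QuantumFields-28167):
`MinimiserStabilityRegPr → FluctuationComparisonRegPrIntL → WindowHerbstL → TowerTailL → TwoSidedOfWindowHerbst → YM3TorusSU2`.
No summit, no Clay statement and no rung is proved here; the rung `YM3TorusSU2` (a RECORD rung) stays open behind the open cruxes
(`WindowHerbstL` new; `TowerTailL`, `MinimiserStabilityRegPr`, `FluctuationComparisonRegPrIntL` shared residuals).  Width seat ym-line-sfw-p2-w2 g20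
(cell `ym-idea-1`, free hands).
-/

namespace Summit.QuantumFields.YangMills.Theorems

open Summit.QuantumFields.YangMills.Theses.MultiscaleHerbst in
/-- The `Assembly` item of route `MultiscaleHerbst` holds: it is the route's deciding theorem `closes` read as an implication. [folklore] -/
theorem multiscaleHerbst_assembly : Summit.QuantumFields.YangMills.Theses.MultiscaleHerbst.Assembly :=
  -- Route rev 2 (2026-08-28T15:27Z) re-keyed `closes` to the capped window items (`WindowHerbstCapL`, `TwoSidedOfWindowHerbstCap`);
  -- this item's statement still reads the ORIGINAL chain (`WindowHerbstL`, `TwoSidedOfWindowHerbst`), so the pre-edit glue is inlined: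
  -- the parent route's deciding theorem on the history tail obtained from the two-sided tail `hG hX` and the tower tail `hT`.
  fun h200 h201 hX hT hG => Summit.QuantumFields.YangMills.Theses.UnitScaleTilt.closes h200 h201
    (Summit.QuantumFields.YangMills.Theorems.fibreConvexityTail_historyTailOfTwoSided_proof (hG hX) hT)

end Summit.QuantumFields.YangMills.Theorems
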